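/-
Copyright (c) 2026 the pub-hodgecm-mathlib formalisation cell (harness21).  Prover seat hodgecm-mathlib-K2Liu-p11 (g0), Track B «K2-LIT»,
#184♮ = hLiu418 = `stmt-HodgeConjecture-24832`; LEAD F0P6-plan (g12) DEAL 2026-09-04T06:56:46Z ∕ «= ×3» 07:19:04Z, SIGS-RoadI-v3 §Hol
row H1-E (K2E5-plan (g5)), file E-4a of H1-E (REPORT-H1E-CENSUS.K2Liu-p11-g0.md §4).  THEOREMS ONLY (no `def`, no `instance`, no notation,
no named-fact hypothesis, no `sorry`).
-/
import Summits.HodgeConjecture.HodgeConjecture.Theorems.K2LiuHermitianTubePChart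
import Literature.AlgebraicGeometry.ShimuraVarieties.UnitaryBallCauchyRiemann
import HarnessLib

/-!
# Crux `HLiu418`, Road I, organ H1-E (hermitian-tube Cauchy–Riemann dictionary), file E-4a:
# the product chart over the places, its linear part, and the local holomorphy criterion

Cell `hodgecm-mathlib`, crux item hLiu418 = `stmt-HodgeConjecture-24832` (helper lane `--supports`, count-neutral).

* §1 `exists_chartEquiv`: for `R₀` invertible and any real-linear parametrisation `η : Eh → M_n(ℂ)` of the hermitian matrices
  (`(η r)ᴴ = η r`, injective, onto), `y = (r₁, r₂) ↦ R₀ (η r₁ + 2i·η r₂) R₀` is a continuous linear EQUIVALENCE `Eh × Eh ≃ (l → l → ℂ)`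
  (injective by uniqueness of the hermitian decomposition, onto by ★ H1-A `re_add_I_smul_im`); `chartEquiv_J`: it intertwines
  `𝒥(r₁, r₂) = (−2 r₂, ½ r₁)` with multiplication by `i`.
* §2 `hasStrictFDerivAt_prodChart`: the product over the places `σ` of the ★ E-2 charts has strict derivative
  `ContinuousLinearEquiv.piCongrRight A` at `0` (★ `hasStrictFDerivAt_chart` + `hasStrictFDerivAt_pi'`).
* §3 `differentiableAt_complex_of_chart` (pure analysis): if `χ` has an invertible strict derivative `𝒜` at `0` with `χ 0 = z₀`, `F ∘ χ = Q`
  with `HasFDerivAt Q L 0`, and a real-linear `𝒥` with `𝒜 ∘ 𝒥 = i·𝒜`, `L ∘ 𝒥 = i·L`, then `F` is complex-differentiable at `z₀`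
  (inverse function theorem + ★ ball-lane `hasFDerivAt_complex_of_real`).
References: ball-lane template ★ `UnitaryBallCauchyRiemann.mem_holomorphic_of_differentiableAt_expP`; [Shimura1997, §§5–6].
HONEST LABEL: HC_CM is proved only modulo the 7 printed citations (2 remaining named inputs: hLiu418 = stmt-HodgeConjecture-24832,
h413 = stmt-HodgeConjecture-24833) until rung 0 closes; count-neutral helper, closes no socket.
-/

set_option autoImplicit false
set_option linter.dupNamespace false

noncomputable section

open scoped Matrix Topology
open Filter Set NormedSpace Complex Matrix
open Literature.NumberTheory.ModularForms.SiegelUpperHalfSpace (num denom moeb)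
open Summit.HodgeConjecture.HodgeConjecture.Cruxes.HLiu418.K2LiuHermitianTubeCocycle
open Summit.HodgeConjecture.HodgeConjecture.Cruxes.HLiu418.K2LiuHermitianTubePChart

namespace Summit.HodgeConjecture.HodgeConjecture.Cruxes.HLiu418.K2LiuHermitianTubeCRChart

variable {l : Type*} [Fintype l] [DecidableEq l]
variable {Eh : Type*} [NormedAddCommGroup Eh] [NormedSpace ℝ Eh] [FiniteDimensional ℝ Eh]

/-! ## §1 The linear part of the chart -/

omit [Fintype l] [DecidableEq l] in
/-- Uniqueness of the hermitian decomposition: `H₁ + 2i H₂ = 0` with `H₁, H₂` hermitian forces `H₁ = H₂ = 0`. [folklore] -/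
theorem herm_decomp_eq_zero {H₁ H₂ : Matrix l l ℂ} (h₁ : H₁ᴴ = H₁) (h₂ : H₂ᴴ = H₂) (h : H₁ + (2 * I) • H₂ = 0) :
    H₁ = 0 ∧ H₂ = 0 := by
  have hc : H₁ - (2 * I) • H₂ = 0 := by
    have := congrArg conjTranspose h
    rw [conjTranspose_add, conjTranspose_smul, h₁, h₂, conjTranspose_zero] at this
    have hstar : star (2 * I) = -(2 * I) := by simp [Complex.conj_I]
    rwa [hstar, neg_smul, ← sub_eq_add_neg] at this
  have hH₁ : H₁ = 0 := by
    have h2 : H₁ + H₁ = 0 := by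
      calc H₁ + H₁ = (H₁ + (2 * I) • H₂) + (H₁ - (2 * I) • H₂) := by abel
        _ = 0 := by rw [h, hc, add_zero]
    rwa [← two_smul ℂ, smul_eq_zero_iff_right (two_ne_zero' ℂ)] at h2
  refine ⟨hH₁, ?_⟩
  rw [hH₁, zero_add, smul_eq_zero_iff_right (mul_ne_zero two_ne_zero I_ne_zero)] at h
  exact h

/-- **The linear part of the chart is invertible.**  For `R₀` invertible and `η` a real-linear isomorphism onto the hermitian matrices,
`(r₁, r₂) ↦ R₀ (η r₁ + 2i η r₂) R₀` is a continuous linear equivalence `Eh × Eh ≃ (l → l → ℂ)`. [cite: Shimura1997, §5.6] -/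
theorem exists_chartEquiv (R₀ : Matrix l l ℂ) (hR₀ : IsUnit R₀.det) (η : Eh →L[ℝ] Matrix l l ℂ)
    (hηH : ∀ r, (η r)ᴴ = η r) (hηi : Function.Injective η) (hηs : ∀ b : Matrix l l ℂ, bᴴ = b → ∃ r, η r = b) :
    ∃ A : (Eh × Eh) ≃L[ℝ] (l → l → ℂ), ∀ y : Eh × Eh,
      (A y : l → l → ℂ) = fun i j => (R₀ * (η y.1 + (2 * I) • η y.2) * R₀) i j := by
  -- the linear map
  set A₀ : (Eh × Eh) →ₗ[ℝ] (l → l → ℂ) :=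
    { toFun := fun y i j => (R₀ * (η y.1 + (2 * I) • η y.2) * R₀) i j
      map_add' := fun y y' => by
        funext i j
        simp only [Prod.fst_add, Prod.snd_add, map_add, smul_add, Pi.add_apply]
        rw [show η y.1 + η y'.1 + ((2 * I) • η y.2 + (2 * I) • η y'.2) =
          (η y.1 + (2 * I) • η y.2) + (η y'.1 + (2 * I) • η y'.2) by abel, Matrix.mul_add, Matrix.add_mul]
        rfl
      map_smul' := fun a y => by
        funext i j
        simp only [Prod.smul_fst, Prod.smul_snd, map_smul, RingHom.id_apply, Pi.smul_apply]
        rw [smul_comm (2 * I) a (η y.2), ← smul_add, Matrix.mul_smul, Matrix.smul_mul]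
        rfl } with hA₀
  have hA₀app : ∀ y : Eh × Eh, A₀ y = fun i j => (R₀ * (η y.1 + (2 * I) • η y.2) * R₀) i j := fun y => rfl
  have hA₀mat : ∀ y : Eh × Eh, Matrix.of (A₀ y) = R₀ * (η y.1 + (2 * I) • η y.2) * R₀ := fun y => rfl
  -- injective
  have hinj : Function.Injective A₀ := by
    intro y y' h
    have h0 : A₀ (y - y') = 0 := by rw [map_sub, h, sub_self]
    have hm : R₀ * (η (y - y').1 + (2 * I) • η (y - y').2) * R₀ = 0 := by
      rw [← hA₀mat, h0]; rfl
    have hm' : η (y - y').1 + (2 * I) • η (y - y').2 = 0 := by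
      have h1 := congrArg (fun M => R₀⁻¹ * M * R₀⁻¹) hm
      simp only [Matrix.mul_zero, Matrix.zero_mul] at h1
      rwa [← Matrix.mul_assoc, ← Matrix.mul_assoc, nonsing_inv_mul _ hR₀, Matrix.one_mul, Matrix.mul_assoc,
        mul_nonsing_inv _ hR₀, Matrix.mul_one] at h1
    obtain ⟨h1, h2⟩ := herm_decomp_eq_zero (hηH _) (hηH _) hm'
    have e1 : (y - y').1 = 0 := hηi (by rw [h1, map_zero])
    have e2 : (y - y').2 = 0 := hηi (by rw [h2, map_zero])
    have : y - y' = 0 := Prod.ext e1 e2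
    exact sub_eq_zero.1 this
  -- surjective
  have hsurj : Function.Surjective A₀ := by
    intro W
    set V : Matrix l l ℂ := R₀⁻¹ * Matrix.of W * R₀⁻¹ with hV
    obtain ⟨r₁, hr₁⟩ := hηs ((2 : ℂ)⁻¹ • (V + Vᴴ)) (isHermitian_re V)
    obtain ⟨r₂, hr₂⟩ := hηs ((2 : ℂ)⁻¹ • ((2 * I)⁻¹ • (V - Vᴴ))) (by
      rw [conjTranspose_smul, (isHermitian_im V).eq]
      simp)
    refine ⟨(r₁, r₂), ?_⟩
    have hsum : η r₁ + (2 * I) • η r₂ = V := by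
      rw [hr₁, hr₂, smul_smul, show (2 * I) * (2 : ℂ)⁻¹ = I by field_simp, re_add_I_smul_im]
    funext i j
    rw [hA₀app]
    simp only
    rw [hsum, hV, ← Matrix.mul_assoc, ← Matrix.mul_assoc, mul_nonsing_inv _ hR₀, Matrix.one_mul, Matrix.mul_assoc,
      nonsing_inv_mul _ hR₀, Matrix.mul_one]
    rfl
  refine ⟨(LinearEquiv.ofBijective A₀ ⟨hinj, hsurj⟩).toContinuousLinearEquiv, fun y => ?_⟩
  rfl

omit [DecidableEq l] [FiniteDimensional ℝ Eh] in
/-- The linear part of the chart intertwines `𝒥(r₁, r₂) = (−2 r₂, ½ r₁)` with multiplication by `i`. [folklore] -/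
theorem chartEquiv_J (R₀ : Matrix l l ℂ) (η : Eh →L[ℝ] Matrix l l ℂ) (A : (Eh × Eh) ≃L[ℝ] (l → l → ℂ))
    (hA : ∀ y : Eh × Eh, (A y : l → l → ℂ) = fun i j => (R₀ * (η y.1 + (2 * I) • η y.2) * R₀) i j) (y : Eh × Eh) :
    A ((-(2 : ℝ)) • y.2, (2 : ℝ)⁻¹ • y.1) = I • A y := by
  have key : η ((-(2 : ℝ)) • y.2) + (2 * I) • η ((2 : ℝ)⁻¹ • y.1) = I • (η y.1 + (2 * I) • η y.2) := by
    rw [map_smul, map_smul, ← Complex.coe_smul, ← Complex.coe_smul, smul_smul, smul_add, smul_smul]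
    push_cast
    rw [show (2 * I) * (2 : ℂ)⁻¹ = I by field_simp,
      show I * (2 * I) = -2 by rw [← mul_assoc, mul_comm I 2, mul_assoc, I_mul_I]; norm_num]
    abel
  rw [hA, hA]
  funext i j
  simp only [Pi.smul_apply, smul_eq_mul]
  rw [key, Matrix.mul_smul, Matrix.smul_mul, Matrix.smul_apply, smul_eq_mul]

/-! ## §2 The product chart over the places -/

section ProdChart

variable {σ : Type*} [Fintype σ]
variable {E₀ : Type*} [NormedAddCommGroup E₀] [NormedSpace ℝ E₀]

/-- **The product chart.**  If at every place `s` the ★ E-2 chart with data `X₀ s, R₀ s, Λ` has strict derivative `A s` at `0`, the product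
map `y ↦ (s ↦ R₀ s · moeb (exp (Λ (y s))) (i·1) · R₀ s + X₀ s)` has strict derivative `piCongrRight A` at `0`. [folklore] -/
theorem hasStrictFDerivAt_prodChart (X₀ R₀ : σ → Matrix l l ℂ) (Λ : E₀ →L[ℝ] Matrix (l ⊕ l) (l ⊕ l) ℂ)
    (A : σ → (E₀ ≃L[ℝ] (l → l → ℂ)))
    (hA : ∀ s y, (A s y : l → l → ℂ) = fun i j =>
      (R₀ s * ((Λ y).toBlocks₁₂ + (Λ y).toBlocks₂₁ + I • ((Λ y).toBlocks₁₁ - (Λ y).toBlocks₂₂)) * R₀ s) i j) :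
    HasStrictFDerivAt
      (fun y : σ → E₀ => fun s => fun i j => (R₀ s * moeb (exp (Λ (y s))) (I • (1 : Matrix l l ℂ)) * R₀ s + X₀ s) i j)
      ((ContinuousLinearEquiv.piCongrRight A : (σ → E₀) ≃L[ℝ] (σ → l → l → ℂ)) : (σ → E₀) →L[ℝ] (σ → l → l → ℂ)) 0 := by
  refine hasStrictFDerivAt_pi'.2 fun s => ?_
  have hs := hasStrictFDerivAt_chart (X₀ s) (R₀ s) Λ (A s) (hA s)
  have hp : HasStrictFDerivAt (fun y : σ → E₀ => y s) (ContinuousLinearMap.proj s : (σ → E₀) →L[ℝ] E₀) 0 :=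
    (ContinuousLinearMap.proj s : (σ → E₀) →L[ℝ] E₀).hasStrictFDerivAt
  have hp0 : (fun y : σ → E₀ => y s) 0 = 0 := rfl
  rw [← hp0] at hs
  have hc := hs.comp 0 hp
  have hder : (A s : E₀ →L[ℝ] (l → l → ℂ)).comp (ContinuousLinearMap.proj s : (σ → E₀) →L[ℝ] E₀) =
      (ContinuousLinearMap.proj s).comp
        ((ContinuousLinearEquiv.piCongrRight A : (σ → E₀) ≃L[ℝ] (σ → l → l → ℂ)) : (σ → E₀) →L[ℝ] (σ → l → l → ℂ)) := by
    ext y i j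
    rfl
  rw [hder] at hc
  exact hc

end ProdChart

/-! ## §3 The local holomorphy criterion -/

section Criterion

variable {E' V : Type*} [NormedAddCommGroup E'] [NormedSpace ℝ E'] [CompleteSpace E']
  [NormedAddCommGroup V] [NormedSpace ℂ V]

/-- **Local holomorphy criterion through a real chart.**  Let `χ : E' → V` have an invertible strict real derivative `𝒜` at `0`, let
`F ∘ χ = Q` near `0` with `HasFDerivAt Q L 0`, and let a real-linear `𝒥` satisfy `𝒜 (𝒥 y) = i·𝒜 y` and `L (𝒥 y) = i·L y`.  Then `F` is
complex-differentiable at `χ 0`. [folklore] -/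
theorem differentiableAt_complex_of_chart {F : V → ℂ} {χ : E' → V} {𝒜 : E' ≃L[ℝ] V}
    (hχ : HasStrictFDerivAt χ (𝒜 : E' →L[ℝ] V) 0) {Q : E' → ℂ} {L : E' →L[ℝ] ℂ} (hQ : HasFDerivAt Q L 0)
    (hFQ : ∀ᶠ y in 𝓝 (0 : E'), F (χ y) = Q y) (𝒥 : E' → E') (h𝒜 : ∀ y, 𝒜 (𝒥 y) = I • 𝒜 y)
    (hL : ∀ y, L (𝒥 y) = I * L y) : DifferentiableAt ℂ F (χ 0) := by
  -- the local inverse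
  set ψ := hχ.localInverse χ 𝒜 0 with hψ
  have hψ0 : ψ (χ 0) = 0 := hχ.localInverse_apply_image
  have hψd : HasFDerivAt ψ (𝒜.symm : V →L[ℝ] E') (χ 0) := hχ.to_localInverse.hasFDerivAt
  have hψc : ContinuousAt ψ (χ 0) := hχ.localInverse_continuousAt
  have hright : ∀ᶠ W in 𝓝 (χ 0), χ (ψ W) = W := hχ.eventually_right_inverse
  -- `F = Q ∘ ψ` near `χ 0`
  have hψnear : ∀ᶠ W in 𝓝 (χ 0), F (χ (ψ W)) = Q (ψ W) := by
    have h := hψc.eventually (show ∀ᶠ y in 𝓝 (ψ (χ 0)), F (χ y) = Q y by rw [hψ0]; exact hFQ)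
    exact h
  have hev : F =ᶠ[𝓝 (χ 0)] Q ∘ ψ := by
    filter_upwards [hright, hψnear] with W hW hW'
    rw [Function.comp_apply, ← hW', hW]
  -- real derivative of `Q ∘ ψ`
  have hQψ : HasFDerivAt (Q ∘ ψ) (L.comp (𝒜.symm : V →L[ℝ] E')) (χ 0) := by
    have hQ' : HasFDerivAt Q L (ψ (χ 0)) := by rw [hψ0]; exact hQ
    exact hQ'.comp (χ 0) hψd
  have hF : HasFDerivAt F (L.comp (𝒜.symm : V →L[ℝ] E')) (χ 0) := hQψ.congr_of_eventuallyEq hev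
  -- the Cauchy–Riemann relations for `L ∘ 𝒜⁻¹`
  have hI : ∀ W : V, (L.comp (𝒜.symm : V →L[ℝ] E')) (I • W) = I • (L.comp (𝒜.symm : V →L[ℝ] E')) W := by
    intro W
    have hJ : 𝒜.symm (I • W) = 𝒥 (𝒜.symm W) := by
      apply 𝒜.injective
      rw [h𝒜, ContinuousLinearEquiv.apply_symm_apply, ContinuousLinearEquiv.apply_symm_apply]
    rw [ContinuousLinearMap.comp_apply, ContinuousLinearMap.comp_apply]
    show L (𝒜.symm (I • W)) = I • L (𝒜.symm W)
    rw [hJ, hL, smul_eq_mul]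
  obtain ⟨L', -, hL'⟩ := Literature.AlgebraicGeometry.ShimuraVarieties.BallForms.hasFDerivAt_complex_of_real hF hI
  exact hL'.differentiableAt

end Criterion

end Summit.HodgeConjecture.HodgeConjecture.Cruxes.HLiu418.K2LiuHermitianTubeCRChart

end
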